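import Mathlib.MeasureTheory.Constructions.Pi
import Mathlib.MeasureTheory.Measure.Prod
import Mathlib.MeasureTheory.Integral.Bochner.Basic
import Mathlib.MeasureTheory.Integral.Bochner.Set
import Mathlib.Algebra.BigOperators.Fin
import Literature.NumberTheory.Transcendental.YoshinagaLattice1D
import HarnessLib

/-!
# Lattice-point counting for tame bounded sets (towards Yoshinaga 2008, Lemma 29)

Second step of the tree's variant of Yoshinaga, *Periods and elementary real numbers*,
arXiv:0805.0349 (2008), §3.4–3.6 (see `YoshinagaLattice1D.lean` for the overview).  For a
measurable set `A ⊆ [-r, r)^m` which is *line-tame with bound `s`* — along every axis-parallel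
line, membership in `A` is constant on each segment avoiding some finite set of at most `s` points
(`Yoshinaga.LineTame`; semialgebraic sets are line-tame, `YoshinagaSignCells.lean`) — the volume
of `A` and the normalised number `#(A ∩ ((1/N)ℤ - r)^m) / N^m` of lattice points of mesh `1/N`
in `A` differ by at most `m · s · (2r)^m / N` (`Yoshinaga.abs_volumeReal_sub_latticeCount_div_le`).
This is the effective rate of convergence which in the paper is Lemma 29
(`|vol(D) - vol(V_n)| < 1/k` for `4 r L √ℓ k < n`), there obtained from the Minkowski content of
`∂D` (Prop. 28, uniformization); here it is proved by induction on `m`, peeling off the first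
coordinate with Tonelli's theorem: the slices of `A` at the lattice abscissae are handled by the
induction hypothesis and the lines in the first coordinate direction by the one-dimensional lemma
`Yoshinaga.abs_volumeReal_sub_card_div_le`, giving the recursion `E_{m+1} = 2r E_m + s (2r)^m / N`.

## Main definitions

* `Yoshinaga.box m r = [-r, r)^m`, `Yoshinaga.latticePoint r N K = (K i / N - r)_i`,
  `Yoshinaga.latticeCount r N A = #{K ∈ {0, …, 2rN-1}^m | latticePoint r N K ∈ A}`.
* `Yoshinaga.LineTame s A`; `Yoshinaga.slice A y`, `Yoshinaga.line A x'` (first coordinate).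

## References

* M. Yoshinaga, *Periods and elementary real numbers*, arXiv:0805.0349 (2008), §3.4, §3.6
  (Lemma 29).
-/

noncomputable section

open scoped Classical
open MeasureTheory Set Finset

namespace Literature.NumberTheory.Transcendental

namespace Yoshinaga

variable {m : ℕ}

/-! ### Boxes, lattice points, lattice counts -/

/-- The half-open box `[-r, r)^m`. [folklore] -/
def box (m r : ℕ) : Set (Fin m → ℝ) := Set.pi univ fun _ => Ico (-(r : ℝ)) r

/-- The lattice point with integer coordinates `K`: `(K i / N - r)_i` (the vertices of
Yoshinaga's cubes `C_n(k)`, 2008, §3.4, translated to a box centred at `0`).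
[cite: Yoshinaga2008, §3.4] -/
def latticePoint (r N : ℕ) (K : Fin m → ℕ) : Fin m → ℝ := fun i => latticeCoord r N (K i)

/-- The number of lattice points of mesh `1/N` of the box `[-r, r)^m` lying in `A` (the tree's
replacement for the number of cubes `C_n(k) ⊆ D` in Yoshinaga's Riemann sum `vol(V_n)`, §3.4).
[cite: Yoshinaga2008, §3.4] -/
def latticeCount (r N : ℕ) (A : Set (Fin m → ℝ)) : ℕ :=
  (univ.filter fun K : Fin m → Fin (2 * r * N) => latticePoint r N (fun i => (K i : ℕ)) ∈ A).card

/-- **Line-tameness.** `A ⊆ ℝ^m` is line-tame with bound `s` if on every axis-parallel line there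
is a set `Z` of at most `s` points such that membership in `A` is constant along every segment
`[t₁, t₂]` of the line avoiding `Z`. (For a semialgebraic set, `Z` = the real roots of the
non-zero restrictions of the defining polynomials; Yoshinaga 2008, §3.4, decides cube membership by
the signs of these polynomials.) [folklore] -/
def LineTame (s : ℕ) (A : Set (Fin m → ℝ)) : Prop :=
  ∀ (k : Fin m) (x : Fin m → ℝ), ∃ Z : Finset ℝ, Z.card ≤ s ∧
    ∀ t₁ t₂ : ℝ, t₁ ≤ t₂ → (∀ z ∈ Z, z ∉ Icc t₁ t₂) →
      (Function.update x k t₁ ∈ A ↔ Function.update x k t₂ ∈ A)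

/-- The slice of `A ⊆ ℝ^{m+1}` at first coordinate `y`. [folklore] -/
def slice (A : Set (Fin (m + 1) → ℝ)) (y : ℝ) : Set (Fin m → ℝ) := {x' | Fin.cons y x' ∈ A}

/-- The trace of `A ⊆ ℝ^{m+1}` on the line in the first coordinate direction through `(·, x')`.
[folklore] -/
def line (A : Set (Fin (m + 1) → ℝ)) (x' : Fin m → ℝ) : Set ℝ := {y | Fin.cons y x' ∈ A}

variable {r N s : ℕ}

/-- Membership in the box, coordinatewise. [folklore] -/
theorem mem_box {x : Fin m → ℝ} : x ∈ box m r ↔ ∀ i, x i ∈ Ico (-(r : ℝ)) r := by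
  simp [box]

/-- `Fin.cons y x'` lies in the box iff `y ∈ [-r, r)` and `x'` lies in the box. [folklore] -/
theorem cons_mem_box {y : ℝ} {x' : Fin m → ℝ} :
    (Fin.cons y x' : Fin (m + 1) → ℝ) ∈ box (m + 1) r ↔ y ∈ Ico (-(r : ℝ)) r ∧ x' ∈ box m r := by
  simp only [mem_box, Fin.forall_fin_succ, Fin.cons_zero, Fin.cons_succ]

/-- The box is measurable. [folklore] -/
theorem measurableSet_box : MeasurableSet (box m r) :=
  MeasurableSet.univ_pi fun _ => measurableSet_Ico

/-- The volume of the box is `(2r)^m`. [folklore] -/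
theorem volume_box : volume (box m r) = ENNReal.ofReal (2 * r) ^ m := by
  rw [box, volume_pi_pi]
  simp only [Real.volume_Ico, Finset.prod_const, Finset.card_univ, Fintype.card_fin]
  congr 2
  ring

/-- The volume of the box is `(2r)^m` (real version). [folklore] -/
theorem volumeReal_box : volume.real (box m r) = (2 * r : ℝ) ^ m := by
  rw [measureReal_def, volume_box, ENNReal.toReal_pow, ENNReal.toReal_ofReal (by positivity)]

/-- The box has finite volume. [folklore] -/
theorem volume_box_ne_top : volume (box m r) ≠ ⊤ := by
  rw [volume_box]; exact ENNReal.pow_ne_top ENNReal.ofReal_ne_top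

/-! ### Slices and lines -/

/-- `(y, x') ↦ Fin.cons y x'` is the inverse of the measurable equivalence `piFinSuccAbove _ 0`.
[folklore] -/
theorem piFinSuccAbove_symm_apply_eq_cons (p : ℝ × (Fin m → ℝ)) :
    (MeasurableEquiv.piFinSuccAbove (fun _ : Fin (m + 1) => ℝ) 0).symm p = Fin.cons p.1 p.2 := by
  simp [MeasurableEquiv.piFinSuccAbove_symm_apply, Fin.insertNthEquiv, Fin.insertNth_zero']

/-- `(y, x') ↦ Fin.cons y x'` is measurable. [folklore] -/
theorem measurable_cons :
    Measurable fun p : ℝ × (Fin m → ℝ) => (Fin.cons p.1 p.2 : Fin (m + 1) → ℝ) := by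
  have hfun : (fun p : ℝ × (Fin m → ℝ) => (Fin.cons p.1 p.2 : Fin (m + 1) → ℝ)) =
      ⇑(MeasurableEquiv.piFinSuccAbove (fun _ : Fin (m + 1) => ℝ) 0).symm :=
    funext fun p => (piFinSuccAbove_symm_apply_eq_cons p).symm
  rw [hfun]
  exact (MeasurableEquiv.piFinSuccAbove (fun _ : Fin (m + 1) => ℝ) 0).symm.measurable

/-- The set of pairs `(y, x')` with `Fin.cons y x' ∈ A` is measurable. [folklore] -/
theorem measurableSet_setOf_cons_mem {A : Set (Fin (m + 1) → ℝ)} (hA : MeasurableSet A) :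
    MeasurableSet {p : ℝ × (Fin m → ℝ) | (Fin.cons p.1 p.2 : Fin (m + 1) → ℝ) ∈ A} :=
  measurable_cons hA

/-- Slices of measurable sets are measurable. [folklore] -/
theorem measurableSet_slice {A : Set (Fin (m + 1) → ℝ)} (hA : MeasurableSet A) (y : ℝ) :
    MeasurableSet (slice A y) :=
  (measurable_cons.comp (measurable_const.prodMk measurable_id)) hA

/-- Lines of measurable sets are measurable. [folklore] -/
theorem measurableSet_line {A : Set (Fin (m + 1) → ℝ)} (hA : MeasurableSet A) (x' : Fin m → ℝ) :
    MeasurableSet (line A x') :=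
  (measurable_cons.comp (measurable_id.prodMk measurable_const)) hA

/-- The volume of `A ⊆ ℝ^{m+1}` in the coordinates `ℝ × ℝ^m`. [folklore] -/
theorem volume_eq_volume_setOf_cons_mem (A : Set (Fin (m + 1) → ℝ)) :
    volume A = (volume : Measure (ℝ × (Fin m → ℝ)))
      {p : ℝ × (Fin m → ℝ) | (Fin.cons p.1 p.2 : Fin (m + 1) → ℝ) ∈ A} := by
  have e := volume_preserving_piFinSuccAbove (fun _ : Fin (m + 1) => ℝ) 0
  rw [← e.measure_preimage_equiv {p : ℝ × (Fin m → ℝ) | (Fin.cons p.1 p.2 : Fin (m + 1) → ℝ) ∈ A}]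
  congr 1
  ext x
  simp only [Set.mem_preimage, mem_setOf_eq]
  rw [← piFinSuccAbove_symm_apply_eq_cons, MeasurableEquiv.symm_apply_apply]

/-- **Tonelli along the first coordinate direction**: the volume of `A` is the integral over
`x' ∈ ℝ^m` of the lengths of the lines of `A`. [folklore] -/
theorem volume_eq_lintegral_volume_line {A : Set (Fin (m + 1) → ℝ)} (hA : MeasurableSet A) :
    volume A = ∫⁻ x', volume (line A x') := by
  rw [volume_eq_volume_setOf_cons_mem, Measure.volume_eq_prod,
    Measure.prod_apply_symm (measurableSet_setOf_cons_mem hA)]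
  rfl

/-- The length of a line of `A` is a measurable function of the base point. [folklore] -/
theorem measurable_volume_line {A : Set (Fin (m + 1) → ℝ)} (hA : MeasurableSet A) :
    Measurable fun x' => volume (line A x') :=
  measurable_measure_prodMk_right (measurableSet_setOf_cons_mem hA) (μ := (volume : Measure ℝ))

/-- Slices of a subset of the box lie in the box. [folklore] -/
theorem slice_subset_box {A : Set (Fin (m + 1) → ℝ)} (hA : A ⊆ box (m + 1) r) (y : ℝ) :
    slice A y ⊆ box m r :=
  fun _ hx => (cons_mem_box.1 (hA hx)).2

/-- Lines of a subset of the box lie in `[-r, r)`. [folklore] -/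
theorem line_subset_Ico {A : Set (Fin (m + 1) → ℝ)} (hA : A ⊆ box (m + 1) r) (x' : Fin m → ℝ) :
    line A x' ⊆ Ico (-(r : ℝ)) r :=
  fun _ hy => (cons_mem_box.1 (hA hy)).1

/-- Lines of a subset of the box over base points outside the box are empty. [folklore] -/
theorem line_eq_empty {A : Set (Fin (m + 1) → ℝ)} (hA : A ⊆ box (m + 1) r) {x' : Fin m → ℝ}
    (hx' : x' ∉ box m r) : line A x' = ∅ :=
  eq_empty_of_forall_notMem fun _ hy => hx' (cons_mem_box.1 (hA hy)).2

/-- Line-tameness passes to slices. [folklore] -/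
theorem LineTame.slice {A : Set (Fin (m + 1) → ℝ)} (h : LineTame s A) (y : ℝ) :
    LineTame s (slice A y) := by
  intro k x
  obtain ⟨Z, hZ, hconst⟩ := h k.succ (Fin.cons y x)
  refine ⟨Z, hZ, fun t₁ t₂ ht hZt => ?_⟩
  have h1 := hconst t₁ t₂ ht hZt
  show Fin.cons y (Function.update x k t₁) ∈ A ↔ Fin.cons y (Function.update x k t₂) ∈ A
  rwa [Fin.cons_update, Fin.cons_update]

/-- Line-tameness along the first coordinate: membership in a line of `A` is constant along
segments avoiding at most `s` points. [folklore] -/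
theorem LineTame.line {A : Set (Fin (m + 1) → ℝ)} (h : LineTame s A) (x' : Fin m → ℝ) :
    ∃ Z : Finset ℝ, Z.card ≤ s ∧ ∀ t₁ t₂ : ℝ, t₁ ≤ t₂ → (∀ z ∈ Z, z ∉ Icc t₁ t₂) →
      (t₁ ∈ line A x' ↔ t₂ ∈ line A x') := by
  obtain ⟨Z, hZ, hconst⟩ := h 0 (Fin.cons 0 x')
  refine ⟨Z, hZ, fun t₁ t₂ ht hZt => ?_⟩
  have h1 := hconst t₁ t₂ ht hZt
  rwa [Fin.update_cons_zero, Fin.update_cons_zero] at h1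

/-! ### The lattice count along the first coordinate -/

/-- Lattice points split along the first coordinate. [folklore] -/
theorem latticePoint_cons (a : ℕ) (K : Fin m → ℕ) :
    latticePoint r N (Fin.cons a K : Fin (m + 1) → ℕ) =
      Fin.cons (latticeCoord r N a) (latticePoint r N K) := by
  ext i
  refine Fin.cases ?_ (fun j => ?_) i
  · simp [latticePoint]
  · simp [latticePoint]

/-- The lattice count of `A ⊆ ℝ^{m+1}` is the sum over the lattice abscissae `a` of the lattice
counts of the slices of `A` at `a / N - r`. [folklore] -/
theorem latticeCount_eq_sum_slice (A : Set (Fin (m + 1) → ℝ)) :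
    latticeCount r N A = ∑ a : Fin (2 * r * N), latticeCount r N (slice A (latticeCoord r N a)) := by
  unfold latticeCount
  simp only [Finset.card_filter]
  rw [← (Fin.consEquiv fun _ : Fin (m + 1) => Fin (2 * r * N)).sum_comp, Fintype.sum_prod_type]
  refine Finset.sum_congr rfl fun a _ => Finset.sum_congr rfl fun K _ => ?_
  have hK : (fun i => ((Fin.consEquiv (fun _ : Fin (m + 1) => Fin (2 * r * N)) (a, K) i : ℕ))) =
      Fin.cons (a : ℕ) (fun i => (K i : ℕ)) := by
    ext i
    refine Fin.cases ?_ (fun j => ?_) i <;> simp [Fin.consEquiv]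
  rw [hK, latticePoint_cons]
  exact if_congr Iff.rfl rfl rfl

/-! ### The discrepancy estimate -/

/-- In dimension `0` the estimate is exact: `ℝ^0` is a point, of volume `1`, and there is exactly
one lattice point. [folklore] -/
theorem abs_volumeReal_sub_latticeCount_div_le_zero (A : Set (Fin 0 → ℝ)) :
    |volume.real A - (latticeCount r N A : ℝ) / (N : ℝ) ^ 0| ≤ 0 := by
  rcases A.eq_empty_or_nonempty with rfl | hne
  · simp [latticeCount]
  · have hA : A = univ := Subsingleton.eq_univ_of_nonempty hne
    subst hA
    have h1 : volume.real (univ : Set (Fin 0 → ℝ)) = 1 := by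
      simp [measureReal_def, volume_pi]
    have h2 : latticeCount r N (univ : Set (Fin 0 → ℝ)) = 1 := by
      simp [latticeCount]
    rw [h1, h2]
    simp

/-- **Lattice-point counting for tame bounded sets** (the tree's form of Yoshinaga 2008, Lemma 29).
If `A ⊆ [-r, r)^m` (`r ≥ 1`) is measurable and line-tame with bound `s`, then for every mesh
`1/N` the volume of `A` and the normalised lattice count `latticeCount r N A / N^m` differ by at
most `m · s · (2r)^m / N`.  Proof by induction on `m`, peeling off the first coordinate: Tonelli
writes `vol(A)` as the integral of the lengths of the lines of `A` and `(1/N) Σ_a vol(slice_a A)`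
as the integral of the normalised lattice counts on these lines, which differ pointwise by
`≤ s/N` (`abs_volumeReal_sub_card_div_le`), whence a difference `≤ s (2r)^m / N`; and the slices
at the `2rN` lattice abscissae are within `E_m` of their own lattice counts by induction, whence
`E_{m+1} ≤ s (2r)^m / N + 2r E_m ≤ (m+1) s (2r)^{m+1} / N`. [cite: Yoshinaga2008, Lemma 29] -/
theorem abs_volumeReal_sub_latticeCount_div_le (hN : 0 < N) (hr : 1 ≤ r) :
    ∀ (m : ℕ) (A : Set (Fin m → ℝ)), MeasurableSet A → A ⊆ box m r → LineTame s A →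
      |volume.real A - (latticeCount r N A : ℝ) / (N : ℝ) ^ m| ≤ m * s * (2 * r) ^ m / N := by
  intro m
  induction m with
  | zero =>
    intro A _ _ _
    refine (abs_volumeReal_sub_latticeCount_div_le_zero A).trans ?_
    simp
  | succ m ih =>
    intro A hA hAbox hT
    have hN' : (0 : ℝ) < N := by exact_mod_cast hN
    have hr' : (1 : ℝ) ≤ 2 * r := by
      have : (1 : ℝ) ≤ r := by exact_mod_cast hr
      linarith
    set B := 2 * r * N with hB
    set E : ℝ := (m : ℝ) * s * (2 * r) ^ m / N with hE
    -- finiteness of lines and slices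
    have hfin_line : ∀ x', volume (line A x') < ⊤ := fun x' =>
      (measure_mono (line_subset_Ico hAbox x')).trans_lt (by simp [Real.volume_Ico])
    have hfin_slice : ∀ y, volume (slice A y) ≠ ⊤ := fun y =>
      ne_top_of_le_ne_top volume_box_ne_top (measure_mono (slice_subset_box hAbox y))
    -- the two integrands
    set f : (Fin m → ℝ) → ℝ := fun x' => volume.real (line A x') with hf
    set g : (Fin m → ℝ) → ℝ := fun x' =>
      (1 / N : ℝ) * ∑ a ∈ Finset.range B, (slice A (latticeCoord r N a)).indicator (fun _ => (1 : ℝ)) x'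
      with hg
    -- (1) the volume of `A` is the integral of the line lengths
    have hvolA : volume.real A = ∫ x', f x' := by
      rw [measureReal_def, volume_eq_lintegral_volume_line hA]
      exact (integral_toReal (measurable_volume_line hA).aemeasurable (ae_of_all _ hfin_line)).symm
    -- (2) integrability
    have hslice_int : ∀ a : ℕ, Integrable
        ((slice A (latticeCoord r N a)).indicator (fun _ : Fin m → ℝ => (1 : ℝ))) volume := fun a =>
      (integrableOn_const (hfin_slice _)).integrable_indicator (measurableSet_slice hA _)
    have hbox_int : Integrable ((box m r).indicator (fun _ : Fin m → ℝ => (1 : ℝ))) volume :=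
      (integrableOn_const volume_box_ne_top).integrable_indicator measurableSet_box
    have hg_int : Integrable g volume :=
      (integrable_finsetSum _ (fun a _ => hslice_int a)).const_mul _
    have hf_int : Integrable f volume := by
      refine Integrable.mono' (hbox_int.const_mul (2 * r : ℝ))
        (measurable_volume_line hA).ennreal_toReal.aestronglyMeasurable (ae_of_all _ fun x' => ?_)
      rw [Real.norm_eq_abs, hf, abs_of_nonneg measureReal_nonneg]
      by_cases hx' : x' ∈ box m r
      · rw [indicator_of_mem hx', mul_one]
        calc volume.real (line A x') ≤ volume.real (Ico (-(r : ℝ)) r) :=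
              measureReal_mono (line_subset_Ico hAbox x') (by simp [Real.volume_Ico])
          _ = 2 * r := by rw [Real.volume_real_Ico_of_le (by linarith)]; ring
      · rw [indicator_of_notMem hx', mul_zero, line_eq_empty hAbox hx', measureReal_empty]
    -- (3) the integral of `g` is the average of the slice volumes at the lattice abscissae
    have hT1 : ∫ x', g x' = (1 / N : ℝ) * ∑ a ∈ Finset.range B, volume.real (slice A (latticeCoord r N a)) := by
      rw [hg, integral_const_mul, integral_finsetSum _ (fun a _ => hslice_int a)]
      congr 1
      refine Finset.sum_congr rfl fun a _ => ?_
      rw [integral_indicator_const _ (measurableSet_slice hA _), smul_eq_mul, mul_one]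
    -- (4) pointwise comparison of `f` and `g` by the one-dimensional lemma
    have hfg : ∀ x', |f x' - g x'| ≤ (s / N : ℝ) * (box m r).indicator (fun _ => (1 : ℝ)) x' := by
      intro x'
      by_cases hx' : x' ∈ box m r
      · rw [indicator_of_mem hx', mul_one]
        obtain ⟨Z, hZ, hconst⟩ := hT.line x'
        have h1 := abs_volumeReal_sub_card_div_le hN (measurableSet_line hA x')
          (line_subset_Ico hAbox x') Z hconst
        have hsum : (∑ a ∈ Finset.range B,
            (slice A (latticeCoord r N a)).indicator (fun _ => (1 : ℝ)) x') =
            (((Finset.range B).filter fun j => latticeCoord r N j ∈ line A x').card : ℝ) := by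
          rw [← Finset.sum_boole]
          refine Finset.sum_congr rfl fun a _ => ?_
          simp only [Set.indicator_apply]
          exact if_congr Iff.rfl rfl rfl
        have hgx : g x' = (((Finset.range B).filter fun j => latticeCoord r N j ∈ line A x').card : ℝ) / N := by
          simp only [hg]
          rw [hsum]
          ring
        calc |f x' - g x'| = |volume.real (line A x') -
              (((Finset.range B).filter fun j => latticeCoord r N j ∈ line A x').card : ℝ) / N| := by
              rw [hgx]
          _ ≤ Z.card / N := h1
          _ ≤ s / N := div_le_div_of_nonneg_right (by exact_mod_cast hZ) hN'.le
      · rw [indicator_of_notMem hx', mul_zero]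
        have hf0 : f x' = 0 := by
          simp only [hf, line_eq_empty hAbox hx', measureReal_empty]
        have hg0 : g x' = 0 := by
          simp only [hg]
          rw [Finset.sum_eq_zero, mul_zero]
          intro a _
          rw [indicator_of_notMem]
          exact fun hmem => hx' (slice_subset_box hAbox _ hmem)
        rw [hf0, hg0, sub_zero, abs_zero]
    -- (5) hence the integrals of `f` and `g` are close
    have hdiff : |(∫ x', f x') - ∫ x', g x'| ≤ (s / N : ℝ) * (2 * r) ^ m := by
      rw [← integral_sub hf_int hg_int]
      calc |∫ x', (f x' - g x')| ≤ ∫ x', |f x' - g x'| := by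
            have h := norm_integral_le_integral_norm (μ := (volume : Measure (Fin m → ℝ)))
              (fun x' => f x' - g x')
            simpa only [Real.norm_eq_abs] using h
        _ ≤ ∫ x', (s / N : ℝ) * (box m r).indicator (fun _ => (1 : ℝ)) x' :=
            integral_mono (hf_int.sub hg_int).abs (hbox_int.const_mul _) hfg
        _ = (s / N : ℝ) * (2 * r) ^ m := by
            rw [integral_const_mul, integral_indicator_const _ measurableSet_box, volumeReal_box,
              smul_eq_mul, mul_one]
    -- (6) the slices at the lattice abscissae, by induction
    have hIH : ∀ a : ℕ, |volume.real (slice A (latticeCoord r N a)) -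
        (latticeCount r N (slice A (latticeCoord r N a)) : ℝ) / (N : ℝ) ^ m| ≤ E := fun a =>
      ih _ (measurableSet_slice hA _) (slice_subset_box hAbox _) (hT.slice _)
    -- (7) the lattice count of `A` from those of the slices
    have hT2 : (latticeCount r N A : ℝ) / (N : ℝ) ^ (m + 1) =
        (1 / N : ℝ) * ∑ a ∈ Finset.range B,
          (latticeCount r N (slice A (latticeCoord r N a)) : ℝ) / (N : ℝ) ^ m := by
      rw [latticeCount_eq_sum_slice,
        ← Fin.sum_univ_eq_sum_range (fun a => (latticeCount r N (slice A (latticeCoord r N a)) : ℝ) / (N : ℝ) ^ m) B]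
      push_cast
      rw [Finset.sum_div, Finset.mul_sum]
      refine Finset.sum_congr rfl fun a _ => ?_
      rw [pow_succ]
      field_simp
    have hslices : |(1 / N : ℝ) * ∑ a ∈ Finset.range B, volume.real (slice A (latticeCoord r N a)) -
        (1 / N : ℝ) * ∑ a ∈ Finset.range B,
          (latticeCount r N (slice A (latticeCoord r N a)) : ℝ) / (N : ℝ) ^ m| ≤ 2 * r * E := by
      rw [← mul_sub, ← Finset.sum_sub_distrib, abs_mul, abs_of_pos (by positivity : (0 : ℝ) < 1 / N)]
      calc (1 / N : ℝ) * |∑ a ∈ Finset.range B, (volume.real (slice A (latticeCoord r N a)) -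
              (latticeCount r N (slice A (latticeCoord r N a)) : ℝ) / (N : ℝ) ^ m)|
          ≤ (1 / N : ℝ) * ∑ a ∈ Finset.range B, |volume.real (slice A (latticeCoord r N a)) -
              (latticeCount r N (slice A (latticeCoord r N a)) : ℝ) / (N : ℝ) ^ m| := by
            gcongr
            exact Finset.abs_sum_le_sum_abs _ _
        _ ≤ (1 / N : ℝ) * ∑ a ∈ Finset.range B, E := by
            gcongr with a _
            exact hIH a
        _ = 2 * r * E := by
            rw [Finset.sum_const, Finset.card_range, nsmul_eq_mul, hB]
            push_cast
            field_simp
    -- (8) conclusion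
    have hfinal : (s / N : ℝ) * (2 * r) ^ m + 2 * r * E ≤ ((m + 1 : ℕ) : ℝ) * s * (2 * r) ^ (m + 1) / N := by
      rw [hE]
      have h0 : (0 : ℝ) ≤ (s : ℝ) * (2 * r) ^ m / N := by positivity
      calc (s / N : ℝ) * (2 * r) ^ m + 2 * r * ((m : ℝ) * s * (2 * r) ^ m / N)
          = (s : ℝ) * (2 * r) ^ m / N * (1 + 2 * r * m) := by ring
        _ ≤ (s : ℝ) * (2 * r) ^ m / N * (2 * r * (m + 1)) := by
            gcongr
            nlinarith
        _ = ((m + 1 : ℕ) : ℝ) * s * (2 * r) ^ (m + 1) / N := by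
            push_cast
            ring
    calc |volume.real A - (latticeCount r N A : ℝ) / (N : ℝ) ^ (m + 1)|
        = |((∫ x', f x') - ∫ x', g x') + ((1 / N : ℝ) * ∑ a ∈ Finset.range B,
              volume.real (slice A (latticeCoord r N a)) -
            (1 / N : ℝ) * ∑ a ∈ Finset.range B,
              (latticeCount r N (slice A (latticeCoord r N a)) : ℝ) / (N : ℝ) ^ m)| := by
          rw [hvolA, hT2, hT1]
          ring_nf
      _ ≤ |(∫ x', f x') - ∫ x', g x'| + |(1 / N : ℝ) * ∑ a ∈ Finset.range B,
              volume.real (slice A (latticeCoord r N a)) -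
            (1 / N : ℝ) * ∑ a ∈ Finset.range B,
              (latticeCount r N (slice A (latticeCoord r N a)) : ℝ) / (N : ℝ) ^ m| := abs_add_le _ _
      _ ≤ (s / N : ℝ) * (2 * r) ^ m + 2 * r * E := add_le_add hdiff hslices
      _ ≤ ((m + 1 : ℕ) : ℝ) * s * (2 * r) ^ (m + 1) / N := hfinal

end Yoshinaga

end Literature.NumberTheory.Transcendental
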